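import Summits.BirchSwinnertonDyer.BirchSwinnertonDyer.Theses.TangentCone

/-!
# `EdgeDecay` — tightness / typing lemmas for the decay witness (traps a proof must step around)

Crux `TangentCone.EdgeDecay` (stmt-BirchSwinnertonDyer-17608), cdisprove seat, cycle 1. The decay clause is
`∀ J ∃ C ∀ m ∃ (k, g, ι, s), 2b(p−1)p^m ∣ k − 2 ∧ 2J+3 ≤ k ∧ b(s−1) = a(k−2) ∧ … ∧ ∀ odd j ∈ [3, 2J+1],
1 ≤ ‖ι(Λ(g,s)/Λ(g,j))‖·p^(r_an(m+1)+C)`. Elementary consequences of the typing (all sorry-free):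
* `four_dvd_weight_sub_two`: `p` odd ⇒ `4 ∣ k − 2`, so the centre `k/2` of the critical strip is ODD;
* `central_index_tested`: if moreover `k ≤ 4J + 2` the centre IS one of the tested `j` — on a branch of root
  number `−1`, `Λ(g_k, k/2) = 0`, Lean's `x / 0 = 0`, and the inequality fails (`not_decay_of_ratio_eq_zero`);
  the existential `k` must therefore be taken `> 4J + 2` (free, but mandatory);
* `linePoint_dvd` / `linePoint_odd`: the line equation forces `2a(p−1)p^m ∣ s − 1`, so `s` is odd (same sign
  component as `j`: periods cancel), `s ≡ 1 (mod p−1)` and `s → 1` `p`-adically with `k → 2` — consistent;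
* `decay_witness_num_den_ne_zero`: any witness ratio has non-zero numerator AND denominator.
-/

set_option linter.dupNamespace false

namespace Summit.BirchSwinnertonDyer.BirchSwinnertonDyer.Theorems.EdgeDecay.Negative

/-- The branch congruence `2b(p−1)p^m ∣ k − 2` with `p` odd forces `4 ∣ k − 2`. [folklore] -/
theorem four_dvd_weight_sub_two {p b m : ℕ} {k : ℤ} (hp : Odd p)
    (hdiv : (2 * b * (p - 1) * p ^ m : ℤ) ∣ (k - 2)) : (4 : ℤ) ∣ k - 2 := by
  obtain ⟨r, hr⟩ := hp
  have h2 : (2 : ℤ) ∣ (p : ℤ) - 1 := ⟨r, by push_cast [hr]; ring⟩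
  obtain ⟨c, hc⟩ := h2
  have h4 : (4 : ℤ) ∣ (2 * b * (p - 1) * p ^ m : ℤ) := ⟨b * c * p ^ m, by rw [hc]; ring⟩
  exact h4.trans hdiv

/-- **Trap.** For a small witness weight `k ≤ 4J + 2` the central point `j = k/2` is a tested
denominator (`j` odd, `3 ≤ j ≤ 2J+1`, `2j = k`). [folklore] -/
theorem central_index_tested {p b m J : ℕ} {k : ℤ} (hp : Odd p)
    (hdiv : (2 * b * (p - 1) * p ^ m : ℤ) ∣ (k - 2)) (hkJ : (2 * J + 3 : ℤ) ≤ k)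
    (hsmall : k ≤ 4 * J + 2) :
    ∃ j : ℕ, Odd j ∧ 3 ≤ j ∧ j ≤ 2 * J + 1 ∧ (2 * j : ℤ) = k := by
  obtain ⟨c, hc⟩ := four_dvd_weight_sub_two hp hdiv
  exact ⟨(2 * c + 1).toNat, ⟨c.toNat, by omega⟩, by omega, by omega, by omega⟩

/-- The line equation on the branch forces `2a(p−1)p^m ∣ s − 1`. [folklore] -/
theorem linePoint_dvd {p a b m : ℕ} {k : ℤ} {s : ℕ} (hb : 0 < b)
    (hdiv : (2 * b * (p - 1) * p ^ m : ℤ) ∣ (k - 2)) (hs : (b : ℤ) * ((s : ℤ) - 1) = a * (k - 2)) :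
    (2 * a * (p - 1) * p ^ m : ℤ) ∣ (s : ℤ) - 1 := by
  obtain ⟨t, ht⟩ := hdiv
  refine ⟨t, ?_⟩
  have hb' : (b : ℤ) ≠ 0 := by exact_mod_cast hb.ne'
  have : (b : ℤ) * ((s : ℤ) - 1) = b * (2 * a * (p - 1) * p ^ m * t) := by rw [hs, ht]; ring
  exact mul_left_cancel₀ hb' this

/-- Hence the point `s` is odd. [folklore] -/
theorem linePoint_odd {p a b m : ℕ} {k : ℤ} {s : ℕ} (hb : 0 < b)
    (hdiv : (2 * b * (p - 1) * p ^ m : ℤ) ∣ (k - 2)) (hs : (b : ℤ) * ((s : ℤ) - 1) = a * (k - 2)) :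
    Odd s := by
  obtain ⟨t, ht⟩ := linePoint_dvd hb hdiv hs
  set X : ℤ := (a : ℤ) * (p - 1) * p ^ m * t with hX
  have h2 : (s : ℤ) - 1 = 2 * X := by rw [ht, hX]; ring
  exact ⟨X.toNat, by omega⟩

/-- **Trap.** A zero ratio never satisfies the decay inequality. [folklore] -/
theorem not_decay_of_ratio_eq_zero {K : Type*} [Field K] {L : Type*} [NormedField L]
    (ι : K →+* L) (c : ℝ) : ¬ (1 ≤ ‖ι 0‖ * c) := by
  simp

/-- Any decay witness has non-zero numerator `Λ(g,s)` and denominator `Λ(g,j)` (Lean's `x / 0 = 0`).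
[folklore] -/
theorem decay_witness_num_den_ne_zero {K : IntermediateField ℚ ℂ} {L : Type*} [NormedField L]
    (ι : K →+* L) {x y : ℂ} (hR : x / y ∈ K) {c : ℝ} (h : 1 ≤ ‖ι ⟨x / y, hR⟩‖ * c) :
    x ≠ 0 ∧ y ≠ 0 := by
  by_contra hxy
  have h0 : x / y = 0 := by
    rcases not_and_or.mp hxy with hx | hy
    · rw [not_not.mp hx, zero_div]
    · rw [not_not.mp hy, div_zero]
  have : (⟨x / y, hR⟩ : K) = 0 := Subtype.ext h0
  rw [this, map_zero, norm_zero, zero_mul] at h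
  exact absurd h (by norm_num)

end Summit.BirchSwinnertonDyer.BirchSwinnertonDyer.Theorems.EdgeDecay.Negative
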